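import Summits.PneNP.PneNP.Theorems.SymmetryBudgetNoHiddenOrderPerPathCGBudget

/-!
# The budgeted certified-label scheme computes a copy of the input block at the root (`NoHiddenOrder`, glue g1–g3 assembled)

Route `PneNP/SymmetryBudget`, `NoHiddenOrder` (stmt-PneNP-14781). Assembling `…PerPathCGProcess` (the concrete process and its realised
valuation, soundness `cg_val_sound`), `…PerPathCGComplete`/`…PerPathCGHeight` (completeness with pass-over heights as values, value range
`|V|`, modulo admissibility) and `…PerPathCGBudget` (every label of the solution subtree satisfies `BudgetBound`): with the ADMISSIBILITY
PREDICATE `BudgetBound` — a `2^{O(|V|)}`-size, relabelling-invariant family of labels (`…PerPathCGCount`) — the certified-label scheme over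
the components-only Corneil–Goldberg process, decoded by replay from a start block with an equitable colouring, OUTPUTS AT THE ROOT THE
COPY OF THE START BLOCK read along some enumeration: an adjacency matrix of a relabelling of the input (`cg_root_value_budget`).

This is the function-level statement the symmetric compilation (R2c) has to realise gate-group by gate-group; nothing about circuits is
here.
-/

-- `Summit.PneNP.PneNP.…` duplicates `PneNP` BY DESIGN (single-problem summit, D-0017 layout).
set_option linter.dupNamespace false

namespace Summit.PneNP.PneNP.Theorems

open Finset

namespace BranchSum

variable {V : Type*} [Fintype V] [DecidableEq V] {G : SimpleGraph V} [DecidableRel G.Adj]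

/-- **The root group of the budgeted scheme outputs a copy of the start block.** For a start block `I₀ = (A₀, col₀)` with `col₀`
equitable inside `A₀`, the value of the root label `(A₀, ∅, 0)` — selector `cgSel`, values the heights `hgt`, decoding by replay,
admissibility `BudgetBound`, value range `|V|` — exists and is `encOf G col₀ l` for an enumeration `l` of `A₀`. -/
theorem cg_root_value_budget (I₀ : CGInst V)
    (hI₀ : ∀ u ∈ I₀.1.1, ∀ u' ∈ I₀.1.1, I₀.1.2 u = I₀.1.2 u' → ∀ w ∈ I₀.1.1,
      ((cellOf I₀.1.1 I₀.1.2 w).filter fun y => G.Adj u y).card = ((cellOf I₀.1.1 I₀.1.2 w).filter fun y => G.Adj u' y).card) :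
    ∃ E : Enc, CertifiedLabels.val (cgProcess G) (cgValuation G) (fun L => CertifiedLabels.replay (cgProcess G) L I₀ ∅)
        (fun L => BudgetBound L.X L.lam) (Fintype.card V) ⟨I₀.1.1, ∅, fun _ => 0⟩ = some E ∧
      ∃ l : List V, l.Nodup ∧ l.toFinset = I₀.1.1 ∧ E = encOf G I₀.1.2 l := by
  have hne := cg_val_ne_none_of_reach_hgt' (G := G) (fun L => BudgetBound L.X L.lam) I₀
    (fun I X lam h => reach_budgetBound hI₀ h) I₀ ∅ (fun _ => 0) CertifiedLabels.Reach.root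
  obtain ⟨E, hE⟩ := Option.ne_none_iff_exists'.1 hne
  refine ⟨E, hE, ?_⟩
  obtain ⟨I, hI, l, hl, hlI, hEl⟩ := cg_val_sound _ _ _ _ E hE
  rw [replay_root_label] at hI
  cases hI
  exact ⟨l, hl, hlI, hEl⟩

/-- The same from the whole vertex set with the coarsest equitable refinement of any start colouring `λ` (e.g. the colouring that
pins the ordered part of a window): the root value is a copy of `G` coloured by `refineIn G univ λ`. -/
theorem cg_root_value_univ [Nonempty V] (lam₀ : V → ℕ) :
    ∃ E : Enc, CertifiedLabels.val (cgProcess G) (cgValuation G)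
        (fun L => CertifiedLabels.replay (cgProcess G) L ⟨(univ, refineIn G univ lam₀), univ_nonempty⟩ ∅)
        (fun L => BudgetBound L.X L.lam) (Fintype.card V) ⟨univ, ∅, fun _ => 0⟩ = some E ∧
      ∃ l : List V, l.Nodup ∧ l.toFinset = univ ∧ E = encOf G (refineIn G univ lam₀) l :=
  cg_root_value_budget (G := G) ⟨(univ, refineIn G univ lam₀), univ_nonempty⟩
    fun _ hu _ hu' huu' _ hw => equitableIn_refineIn univ lam₀ hu hu' huu' hw

end BranchSum

end Summit.PneNP.PneNP.Theorems
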